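import Literature.IUT.HodgeArakelov.KummerPrimeStripsProofs

/-!
# [IUTchII] Definition 4.9 (ii)–(iv): non-vacuity of the local datum `‡F^{⊢▶×μ}_w` (companion to
# `KummerPrimeStrips.lean`, theorem-only)

S. Mochizuki, *Inter-universal Teichmüller theory II*, §4, Definition 4.9 (i)–(iv) (kurims Dec-2020
manuscript pp. 154–156) [cite: Mochizuki2012, Def 4.9 (iii) p.155]. Claim key DISPUTED (D-0012):
nothing here asserts a disputed claim or takes a side on [IUTchIII] Cor 3.12. PROOF-ONLY companion
(abc-iut cell, layer L6, node **IUTchII:Def4.9(iii)**/(iv); WAVE-3 seat abc-iut-L6-d7; the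
"non-vacuity model file for `OPerpPresentsAssociates`/`NonarchTriMuDatum`" named by abc-iut-L6-t2,
STATUS 19:13:55Z, and by the L6 DISCHARGE BOARD 19:40:32Z): no new definitions.

**What is shown.** abc-iut-L6-t2's INTERFACE `NonarchTriMuDatum l k G X` (Def 4.9 (ii)–(iv): the
monoid `O^▷(‡A)` with `‡G`-action, the splitting image, the presentation `O^⊥/μ_{2l} ⥲ O^▷/O^×`
(`presents`), and the `×`- and `×μ`-Kummer structures `‡κ^{⊢×}_w`, `‡κ^{⊢×μ}_w` of Def 4.9 (i)) is
INHABITED, for every prime `l`, every type of nonarchimedean place `k` and every group `G`, by HONEST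
monoid data: `O^▷ := R ∖ {0}` for a discrete valuation ring `R` (e.g. `𝒪_{K_v}`), splitting `ϖ^ℕ`
(`presents` by `OPerpPresentsAssociates_nonZeroDivisors_powers`), the TRIVIAL `G`-action, and — for
the Kummer structures, whose genuine input `G ↷ O^×(G)` is the [AbsTopIII] Cor 1.10 output owned by
abc-iut-L4-t1/L6-t1 — the TAUTOLOGICAL group-theoretic units `O^×(G) := O^×` with `Im(Ẑ^×) := 1`, on
which the identity is a `×`-Kummer structure and the `Ism`-orbit of the identity a `×μ`-Kummer
structure. This certifies that the fields of the interface are jointly satisfiable (no field is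
contradictory, `presents` is compatible with the rest); it does NOT model the anabelian content of
`‡κ^{⊢×}_w` (uniqueness of the `Ẑ^×`-orbit, Remark 1.11.1 (b) — a named hypothesis elsewhere).
-/

namespace Literature.IUT.HodgeArakelov

open scoped nonZeroDivisors

universe u v

section NonVacuity

variable {R : Type v} [CommRing R] [IsDomain R] [IsDiscreteValuationRing R]
variable (G : Type u) [Group G]

/-- **IUTchII:Def4.9(i)** (kurims p.154) TAUTOLOGICAL `×`-Kummer structure: for any covering monoid
`G ↷ O^▷(A)`, taking as "group-theoretic units" the `G`-module `O^×(A)` itself with `Im(Ẑ^×) := 1`, the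
singleton `{id}` is a `Ẑ^×`-orbit of `G`-equivariant isomorphisms `O^×(G) ⥲ O^×(A)`, i.e. a
`KummerTimes` (non-vacuity of the interface; the genuine `O^×(G)` is [AbsTopIII] Cor 1.10's output).
[cite: Mochizuki2012, Def 4.9 (i) p.154] -/
theorem nonempty_kummerTimes_tautological (M : CoveringMonoid.{u, v} G) (opens : Set (Subgroup G)) :
    Nonempty (KummerTimes
      ({ OxG := M.Oˣ, act := M.unitsAct, openSubgroups := opens, zhatUnits := ⊥,
         zhatUnits_comm := fun γ hγ g => by rw [Subgroup.mem_bot.mp hγ, one_mul, mul_one] } :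
        GroupTheoreticUnits.{u, v} G) M) := by
  refine ⟨⟨{κ' | κ'.toMulEquiv = MulEquiv.refl _}, ⟨MulEquiv.refl _, fun _ _ => rfl⟩, rfl,
    fun κ' => ?_⟩⟩
  have h1 : MulEquiv.trans (1 : MulAut M.Oˣ) (MulEquiv.refl M.Oˣ) = MulEquiv.refl M.Oˣ :=
    MulEquiv.ext fun _ => rfl
  constructor
  · intro (h : κ'.toMulEquiv = MulEquiv.refl _)
    exact ⟨1, Subgroup.one_mem _, by rw [h1]; exact h⟩
  · rintro ⟨γ, hγ, hκ'⟩
    have hγ1 : γ = 1 := Subgroup.mem_bot.mp hγ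
    rw [hγ1, h1] at hκ'
    exact hκ'

/-- **IUTchII:Def4.9(i)** (kurims p.154) TAUTOLOGICAL `×μ`-Kummer structure: with the same tautological
group-theoretic units, the `Ism`-orbit of the identity of `O^{×μ}(A)` is a `KummerTimesMu`
(non-vacuity of the interface). [cite: Mochizuki2012, Def 4.9 (i) p.154] -/
theorem nonempty_kummerTimesMu_tautological (M : CoveringMonoid.{u, v} G)
    (opens : Set (Subgroup G)) :
    Nonempty (KummerTimesMu
      ({ OxG := M.Oˣ, act := M.unitsAct, openSubgroups := opens, zhatUnits := ⊥,
         zhatUnits_comm := fun γ hγ g => by rw [Subgroup.mem_bot.mp hγ, one_mul, mul_one] } :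
        GroupTheoreticUnits.{u, v} G) M) := by
  have h1 : MulEquiv.trans (1 : MulAut (UnitsModTorsion M.O)) (MulEquiv.refl _) = MulEquiv.refl _ :=
    MulEquiv.ext fun _ => rfl
  refine ⟨⟨{κ' | ∃ γ ∈ isometryGroup M.unitsAct opens,
      κ'.toMulEquiv = γ.trans (MulEquiv.refl (UnitsModTorsion M.O))},
    ⟨MulEquiv.refl _, fun _ _ => rfl⟩, ⟨1, Subgroup.one_mem _, h1.symm⟩, fun κ' => Iff.rfl⟩⟩

/-- **IUTchII:Def4.9(iii)**/(iv) (kurims pp.155–156) NON-VACUITY of abc-iut-L6-t2's interface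
`NonarchTriMuDatum l k G X` for EVERY `l`, every nonarchimedean place type `k` (so `twoL = 2l` or `1`)
and every group `G`: inhabited by the split monoid `O^▷ := R ∖ {0}` of a discrete valuation ring `R`
with splitting `ϖ^ℕ` (`presents` = `OPerpPresentsAssociates_nonZeroDivisors_powers`), trivial
`G`-action, and the tautological Kummer structures above. [cite: Mochizuki2012, Def 4.9 (iii) p.155] -/
theorem nonempty_nonarchTriMuDatum (l : ℕ) (k : PlaceKind) {ϖ : R} (hϖ : Irreducible ϖ) :
    ∃ X : GroupTheoreticUnits.{u, v} G, Nonempty (NonarchTriMuDatum.{u, v, v} l k G X) := by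
  let M : CoveringMonoid.{u, v} G := ⟨CommMonCat.of R⁰, 1⟩
  let X : GroupTheoreticUnits.{u, v} G :=
    { OxG := M.Oˣ, act := M.unitsAct, openSubgroups := Set.univ, zhatUnits := ⊥,
      zhatUnits_comm := fun γ hγ g => by rw [Subgroup.mem_bot.mp hγ, one_mul, mul_one] }
  obtain ⟨κ⟩ := nonempty_kummerTimes_tautological G M Set.univ
  obtain ⟨κμ⟩ := nonempty_kummerTimesMu_tautological G M Set.univ
  exact ⟨X, ⟨⟨CommMonCat.of R⁰, 1,
    Submonoid.powers (⟨ϖ, mem_nonZeroDivisors_of_ne_zero hϖ.ne_zero⟩ : R⁰),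
    OPerpPresentsAssociates_nonZeroDivisors_powers hϖ (torsionOrder l k), κ, κμ⟩⟩⟩

/-- **IUTchII:Def4.9(iii)**/(iv) The same, with the DVR's uniformizer chosen internally: for every
discrete valuation ring `R`, prime `l`, place type `k` and group `G`, SOME group-theoretic-units datum
`X` admits a `NonarchTriMuDatum l k G X` whose monoid is `R ∖ {0}`.
[cite: Mochizuki2012, Def 4.9 (iii) p.155] -/
theorem nonempty_nonarchTriMuDatum' (l : ℕ) (k : PlaceKind) :
    ∃ X : GroupTheoreticUnits.{u, v} G, ∃ D : NonarchTriMuDatum.{u, v, v} l k G X,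
      (D.O : Type v) = R⁰ := by
  obtain ⟨ϖ, hϖ⟩ := IsDiscreteValuationRing.exists_irreducible R
  let M : CoveringMonoid.{u, v} G := ⟨CommMonCat.of R⁰, 1⟩
  obtain ⟨κ⟩ := nonempty_kummerTimes_tautological G M Set.univ
  obtain ⟨κμ⟩ := nonempty_kummerTimesMu_tautological G M Set.univ
  exact ⟨_, ⟨CommMonCat.of R⁰, 1,
    Submonoid.powers (⟨ϖ, mem_nonZeroDivisors_of_ne_zero hϖ.ne_zero⟩ : R⁰),
    OPerpPresentsAssociates_nonZeroDivisors_powers hϖ (torsionOrder l k), κ, κμ⟩, rfl⟩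

end NonVacuity

end Literature.IUT.HodgeArakelov
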